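/-
Copyright (c) 2026. All rights reserved.
Released under Apache 2.0 license as described in the file LICENSE.
Authors: abc-iut cell, seat abc-iut-w5-d226 (gen 3; ROW «P13-INPUT-BRIDGE», L4-lead RULING #5i (3)).
-/
import Literature.AnabelianGeometry.AbsoluteAnabelian.AbsTopII.InertiaDecompositionProofs
import Literature.AnabelianGeometry.AbsoluteAnabelian.AbsTopII.InertiaDecompositionImageOpen
import Literature.AnabelianGeometry.AbsoluteAnabelian.AbsTopII.InertiaDecompositionProducts
import Literature.AnabelianGeometry.SemiGraphs.PSCGraphicity
import HarnessLib

/-!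
# [AbsTopII] Prop 1.3: the `Π_𝔾`-inputs of the group-theoretic layer READ FROM layer L3's PSC datum

S. Mochizuki, *Topics in Absolute Anabelian Geometry II* [AbsTopII] (bib `MochizukiAbsTopII2013`;
locators = PDF pages of the kurims manuscript `paper:url-585b8d0ad0d9`), §1, Def 1.2 (ii) p. 10 and
Prop 1.3 pp. 11–12 (proof pp. 12–19); S. Mochizuki, *A combinatorial version of the Grothendieck
conjecture* [CombGC] (bib `MochizukiCombGC2007`), Def 1.1 (ii) pp. 6–7, Prop 1.2 (i)(ii) p. 8,
Def 1.4 (i) p. 10.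

The group-theoretic layer of the printed proof of Prop 1.3 (sub-DAG `plan/L4/SUBDAG-AbsTopII-Prop13.md`,
files `AbsTopII/InertiaDecomposition{Core,Proofs,Openness,Products,ImageOpen}.lean`) is PROVED over the
abstract `DPSCData` modulo INPUT rows stated in [AbsTopII]'s own words:

* I-GR  (Def 1.2 (ii) p. 10, "`ρ_H : H → Aut(𝒢) (⊆ Out(Π_𝒢))`", `Π_H := Π_𝒢 ⋊^out H`): every
  `Π_H`-conjugate of a verticial / edge-like subgroup is a `Π_𝔾`-conjugate of the verticial /
  edge-like subgroup of some vertex / edge;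
* I-C12i ([CombGC] Prop 1.2 (i) p. 8): "If `A₁ ∩ A₂` is open in `A₁`, then `v₁ = v₂`";
* I-C12ii ([CombGC] Prop 1.2 (ii) p. 8): "The `Aᵢ` are commensurably terminal in `Π_𝒢`";
* I-img (Prop 1.3 (vi)/(ix) first halves): PROVED from I-GR + finiteness + closedness by
  `DPSCData.isOpen_map_Dv` (abc-iut f-065, `InertiaDecompositionImageOpen.lean`).

Layer L3 (abc-iut-L3-t4) types [CombGC] §1 over the interface `SemiGraphs.PSCDatum Π` — the datum a
semi-graph of anabelioids of pro-`Σ` PSC-type with PSC-fundamental group `Π` determines — with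
[CombGC] Prop 1.2 (i)/(ii) as the PREDICATES `PSCDatum.VerticialOpenInterDeterminesVertex`,
`PSCDatum.EdgeLikeOpenInterDeterminesEdge`, `PSCDatum.VerticialEdgeLikeCommensurablyTerminal` (their
printed universal statements are `OpenInterDeterminesComponentHolds Ω` / `CommensurableTerminalityHolds Ω`,
FACT-LIST F-0459 / F-0438) and Def 1.4 (i) "graphic" as `PSCDatum.IsGraphic`.

This PROOF-ONLY file (no definitions) is the BRIDGE: for DPSC data `X` whose closed normal subgroup
`Π_𝔾 ⊆ Π_H` carries a PSC datum `G : PSCDatum ↥X.PiG` ([CombGC] Def 1.1 (ii): "`Π_𝒢` … the PSC-fundamental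
group of `𝒢`") PRESENTING `X` — bijections of vertices / nodes / cusps under which each chosen
`Π_v, Π_e ⊆ Π_𝔾` of `X` is, inside `Π_𝔾`, a conjugate of the corresponding representative of `G`
(hypotheses `hV`, `hN`, `hC`; "a vertex (respectively, edge) of `𝔾` determines, up to conjugation, a
closed subgroup", [CombGC] p. 6) — the input rows become consequences BY NAME of the L3 predicates:

* I-C12ii ⇐ `G.VerticialEdgeLikeCommensurablyTerminal` (`isCommensurablyTerminal_vertSub_of_psc`, …);
* I-C12i  ⇐ `G.VerticialOpenInterDeterminesVertex` / `G.EdgeLikeOpenInterDeterminesEdge`, in BOTH the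
  finite-index form used by files (A)/(B) and the printed "open in" form used by (C)
  (`vertDet_of_psc`, `vertDet_isOpen_form_of_psc`, …);
* closedness of `Π_v, Π_e` in `Π_H` ⇐ the `isClosed_*` fields of `G` (`isClosed_vertSub_of_psc`, …);

the companion `AbsTopII/DPSCDataOfSemiGraphGraphic.lean` adds I-GR ⇐ "conjugation by every `h ∈ Π_H`
restricts to a GRAPHIC automorphism of (`Π_𝔾`, `G`)" ([CombGC] Def 1.4 (i)) and the typed conclusions
`prop13vii/v/vi/ix/iii_of_psc` with the `Π_𝔾`-inputs discharged on the L3 side.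

What stays a hypothesis BY NAME (no L3 decl exists today; plan/L4/SUBDAG-AbsTopII-Prop13.md): `Π_𝔾`
slim nontrivial and `Π_v` slim ([CombGC] Rmk 1.1.3 — not typed under `SemiGraphs/`), "(iv) at open
subgroups" (`hL`), `I_v` infinite / `I_v ↠ I` / `Π_e ≤ I_e` (Prop 1.3 (ii)(iii), geometric), `Π_e`
abelian for cusps (Prop 1.3 (i)).  A profinite `Π_𝔾 ⋊^out H` is not constructed here (layer L3's
`SemiGraphs.outerSemidirectProduct` is algebraic only); the bridge therefore presents a GIVEN
DPSC-extension by a PSC datum rather than building one.  HONEST FRAMING: classical group theory over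
two typed interfaces; typed ≠ proved; nothing here bears on [IUTchIII] Cor 3.12 or takes a side.
-/

open scoped Pointwise

namespace Literature.AnabelianGeometry.AbsoluteAnabelian

open Literature.AlgebraicGeometry.Frobenioids (IsSlimGroup)
open Literature.AnabelianGeometry.SemiGraphs

universe u

/-! ## §A. Generic bookkeeping: reading conjugates inside a normal subgroup -/

section Generic

variable {Γ : Type u} [Group Γ] (N : Subgroup Γ)

/-- `ConjAct`- and `MulAut.conj`-conjugates of a subgroup coincide (the two spellings of "determines, up
to conjugation, a closed subgroup" used by layers L3 and L4). [cite: MochizukiCombGC2007, Def 1.1(ii) p.6] -/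
theorem toConjAct_smul_subgroup_eq (g : Γ) (K : Subgroup Γ) :
    ConjAct.toConjAct g • K = MulAut.conj g • K := by
  ext x
  rw [Subgroup.mem_pointwise_smul_iff_inv_smul_mem, Subgroup.mem_pointwise_smul_iff_inv_smul_mem,
    ← map_inv, ← map_inv, ConjAct.toConjAct_smul_eq_mulAut_conj, MulAut.smul_def]

/-- Reading the `Π_H`-conjugate `γ·K·γ⁻¹` of `K` by an element `γ ∈ N` inside `N`: it is the
`N`-conjugate of `K ∩ N` by `γ` ("up to conjugation in `Π_𝒢`", [AbsTopII] Def 1.2 (ii) p. 10).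
[cite: MochizukiAbsTopII2013, Def 1.2 (ii) p.10] -/
theorem subgroupOf_conj_smul_of_mem (K : Subgroup Γ) (γ : ↥N) :
    (MulAut.conj (γ : Γ) • K).subgroupOf N = ConjAct.toConjAct γ • K.subgroupOf N := by
  ext x
  rw [Subgroup.mem_subgroupOf, Subgroup.mem_pointwise_smul_iff_inv_smul_mem,
    Subgroup.mem_pointwise_smul_iff_inv_smul_mem, ← map_inv, ← map_inv, MulAut.smul_def,
    MulAut.conj_apply, ConjAct.toConjAct_smul_eq_mulAut_conj, Subgroup.mem_subgroupOf, MulAut.conj_apply]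
  simp

/-- Reading the conjugate `h·K·h⁻¹` (`h ∈ Π_H` arbitrary) inside `N` through an automorphism `α` of
`N` that agrees with conjugation by `h` (the outer action "`Π_H = Π_𝒢 ⋊^out H`" of [AbsTopII] Def 1.2
(ii) p. 10 read on subgroups). [cite: MochizukiAbsTopII2013, Def 1.2 (ii) p.10] -/
theorem subgroupOf_conj_smul_eq_map (K : Subgroup Γ) (h : Γ) (α : ↥N ≃* ↥N)
    (hα : ∀ x : ↥N, ((α x : ↥N) : Γ) = h * x * h⁻¹) :
    (MulAut.conj h • K).subgroupOf N = (K.subgroupOf N).map α.toMonoidHom := by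
  ext x
  rw [Subgroup.mem_subgroupOf, Subgroup.mem_pointwise_smul_iff_inv_smul_mem, ← map_inv, MulAut.smul_def,
    MulAut.conj_apply, inv_inv, Subgroup.mem_map]
  constructor
  · intro hx
    refine ⟨α.symm x, ?_, by simp⟩
    rw [Subgroup.mem_subgroupOf]
    have h1 : ((α (α.symm x) : ↥N) : Γ) = h * (α.symm x : ↥N) * h⁻¹ := hα _
    rw [α.apply_symm_apply] at h1
    have h2 : ((α.symm x : ↥N) : Γ) = h⁻¹ * x * h := by
      rw [h1]; group
    rw [h2]; exact hx
  · rintro ⟨y, hy, rfl⟩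
    rw [Subgroup.mem_subgroupOf] at hy
    change h⁻¹ * ((α.toMonoidHom y : ↥N) : Γ) * h ∈ K
    rw [MulEquiv.coe_toMonoidHom, hα]
    simpa [mul_assoc] using hy

/-- Two subgroups of `N` with the same trace on `N` are equal (subgroups of `Π_𝒢` read inside `Π_𝒢`,
[CombGC] Def 1.1 (ii) p. 6). [cite: MochizukiCombGC2007, Def 1.1(ii) p.6] -/
theorem eq_of_subgroupOf_eq {H₁ H₂ : Subgroup Γ} (h₁ : H₁ ≤ N) (h₂ : H₂ ≤ N)
    (h : H₁.subgroupOf N = H₂.subgroupOf N) : H₁ = H₂ := by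
  have := Subgroup.subgroupOf_inj.mp h
  rwa [inf_eq_left.mpr h₁, inf_eq_left.mpr h₂] at this

/-- A `Π_H`-conjugate of a subgroup of the normal subgroup `N = Π_𝒢` lies in `N` ([AbsTopII] Def 1.2
(ii) p. 10: `Π_𝒢 ⊆ Π_H` normal). [cite: MochizukiAbsTopII2013, Def 1.2 (ii) p.10] -/
theorem mulAut_conj_smul_le_of_normal [N.Normal] {K : Subgroup Γ} (hK : K ≤ N) (h : Γ) : MulAut.conj h • K ≤ N := by
  intro x hx
  rw [Subgroup.mem_pointwise_smul_iff_inv_smul_mem, ← map_inv, MulAut.smul_def, MulAut.conj_apply,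
    inv_inv] at hx
  have := Subgroup.Normal.conj_mem ‹N.Normal› _ (hK hx) h
  simpa [mul_assoc] using this

/-- Conjugates of closed subgroups are closed (`ConjAct` spelling of abc-iut-L4's
`isClosed_mulAut_conj_smul`; [CombGC] Def 1.1 (ii) p. 6 "a closed subgroup … up to conjugation").
[cite: MochizukiCombGC2007, Def 1.1(ii) p.6] -/
theorem isClosed_conjAct_smul [TopologicalSpace Γ] [IsTopologicalGroup Γ] {K : Subgroup Γ}
    (hK : IsClosed (K : Set Γ)) (δ : ConjAct Γ) : IsClosed ((δ • K : Subgroup Γ) : Set Γ) := by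
  rw [← ConjAct.toConjAct_ofConjAct δ, toConjAct_smul_subgroup_eq]
  exact isClosed_mulAut_conj_smul hK _

/-- A subgroup of a closed subgroup `N` which is closed in `N` is closed (closed subgroups of `Π_𝒢` are
closed in `Π_H`; [CombGC] Def 1.1 (ii) p. 6). [cite: MochizukiCombGC2007, Def 1.1(ii) p.6] -/
theorem isClosed_of_subgroupOf_isClosed [TopologicalSpace Γ] {K : Subgroup Γ} (hK : K ≤ N)
    (hN : IsClosed (N : Set Γ)) (hc : IsClosed ((K.subgroupOf N : Subgroup ↥N) : Set ↥N)) :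
    IsClosed (K : Set Γ) := by
  have hKN : (K : Set Γ) = Subtype.val '' ((K.subgroupOf N : Subgroup ↥N) : Set ↥N) := by
    ext x
    simp only [SetLike.mem_coe, Set.mem_image, Subgroup.mem_subgroupOf, Subtype.exists, exists_and_right,
      exists_eq_right]
    exact ⟨fun hx => ⟨hK hx, hx⟩, fun ⟨_, hx⟩ => hx⟩
  rw [hKN]
  exact hN.isClosedEmbedding_subtypeVal.isClosedMap _ hc

end Generic

/-! ## §B. The bridge at `DPSCData` presented by a PSC datum on `Π_𝔾` -/

namespace DPSCData

variable (X : DPSCData.{u}) (G : PSCDatum ↥X.PiG)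
  (eV : X.Vert ≃ G.graph.V) (eN : X.Node ≃ G.graph.N) (eC : X.Cusp ≃ G.graph.C)

/-! ### I-C12ii ⇐ [CombGC] Prop 1.2 (ii) -/

/-- **Input I-C12ii (vertices) from layer L3**: if each chosen `Π_v` of `X` is, inside `Π_𝔾`, a
conjugate of `G`'s verticial representative, then [CombGC] Prop 1.2 (ii) for `G`
(`VerticialEdgeLikeCommensurablyTerminal`) gives the commensurable terminality of `Π_v` in `Π_𝔾`
exactly as consumed by files (A)/(B)/(C)/(E). [cite: MochizukiCombGC2007, Prop 1.2(ii) p.8] -/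
theorem isCommensurablyTerminal_vertSub_of_psc
    (hV : ∀ v, ∃ δ : ConjAct ↥X.PiG, (X.vertSub v).subgroupOf X.PiG = δ • G.vertGp (eV v))
    (hCT : G.VerticialEdgeLikeCommensurablyTerminal) (v : X.Vert) :
    IsCommensurablyTerminal ((X.vertSub v).subgroupOf X.PiG) := by
  obtain ⟨δ, hδ⟩ := hV v
  exact ⟨hCT _ (Or.inl ⟨eV v, δ, hδ⟩)⟩

/-- **Input I-C12ii (nodes) from layer L3.** [cite: MochizukiCombGC2007, Prop 1.2(ii) p.8] -/
theorem isCommensurablyTerminal_nodeSub_of_psc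
    (hN : ∀ e, ∃ δ : ConjAct ↥X.PiG, (X.nodeSub e).subgroupOf X.PiG = δ • G.nodeGp (eN e))
    (hCT : G.VerticialEdgeLikeCommensurablyTerminal) (e : X.Node) :
    IsCommensurablyTerminal ((X.nodeSub e).subgroupOf X.PiG) := by
  obtain ⟨δ, hδ⟩ := hN e
  exact ⟨hCT _ (Or.inr (Or.inl ⟨eN e, δ, hδ⟩))⟩

/-- **Input I-C12ii (cusps) from layer L3.** [cite: MochizukiCombGC2007, Prop 1.2(ii) p.8] -/
theorem isCommensurablyTerminal_cuspSub_of_psc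
    (hC : ∀ e, ∃ δ : ConjAct ↥X.PiG, (X.cuspSub e).subgroupOf X.PiG = δ • G.cuspGp (eC e))
    (hCT : G.VerticialEdgeLikeCommensurablyTerminal) (e : X.Cusp) :
    IsCommensurablyTerminal ((X.cuspSub e).subgroupOf X.PiG) := by
  obtain ⟨δ, hδ⟩ := hC e
  exact ⟨hCT _ (Or.inr (Or.inr ⟨eC e, δ, hδ⟩))⟩

/-! ### Closedness and finiteness from the PSC datum -/

/-- `Π_v` is closed in `Π_H` ([CombGC] Def 1.1 (ii) "a closed subgroup"; `G.isClosed_vertGp`).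
[cite: MochizukiCombGC2007, Def 1.1(ii) p.6] -/
theorem isClosed_vertSub_of_psc
    (hV : ∀ v, ∃ δ : ConjAct ↥X.PiG, (X.vertSub v).subgroupOf X.PiG = δ • G.vertGp (eV v))
    (v : X.Vert) : IsClosed (X.vertSub v : Set X.PiH) := by
  obtain ⟨δ, hδ⟩ := hV v
  refine isClosed_of_subgroupOf_isClosed X.PiG (X.vertSub_le v) X.isClosed_PiG ?_
  rw [hδ]
  exact isClosed_conjAct_smul (G.isClosed_vertGp _) δ

/-- `Π_e` (node) is closed in `Π_H`. [cite: MochizukiCombGC2007, Def 1.1(ii) p.7] -/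
theorem isClosed_nodeSub_of_psc
    (hN : ∀ e, ∃ δ : ConjAct ↥X.PiG, (X.nodeSub e).subgroupOf X.PiG = δ • G.nodeGp (eN e))
    (e : X.Node) : IsClosed (X.nodeSub e : Set X.PiH) := by
  obtain ⟨δ, hδ⟩ := hN e
  refine isClosed_of_subgroupOf_isClosed X.PiG (X.nodeSub_le e) X.isClosed_PiG ?_
  rw [hδ]
  exact isClosed_conjAct_smul (G.isClosed_nodeGp _) δ

/-- `Π_e` (cusp) is closed in `Π_H`. [cite: MochizukiCombGC2007, Def 1.1(ii) p.7] -/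
theorem isClosed_cuspSub_of_psc
    (hC : ∀ e, ∃ δ : ConjAct ↥X.PiG, (X.cuspSub e).subgroupOf X.PiG = δ • G.cuspGp (eC e))
    (e : X.Cusp) : IsClosed (X.cuspSub e : Set X.PiH) := by
  obtain ⟨δ, hδ⟩ := hC e
  refine isClosed_of_subgroupOf_isClosed X.PiG (X.cuspSub_le e) X.isClosed_PiG ?_
  rw [hδ]
  exact isClosed_conjAct_smul (G.isClosed_cuspGp _) δ

/-! ### I-C12i ⇐ [CombGC] Prop 1.2 (i) -/

/-- In a compact group an open subgroup of `A₁` has finite index: the printed "open in `A₁`"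
hypothesis of [CombGC] Prop 1.2 (i) p. 8 implies the finite-index hypothesis of files (A)/(B).
[cite: MochizukiCombGC2007, Prop 1.2(i) p.8] -/
theorem relIndex_ne_zero_of_isOpen_subgroupOf {A S : Subgroup X.PiH} (hA : IsClosed (A : Set X.PiH))
    (h : IsOpen (((S ⊓ A).subgroupOf A : Subgroup ↥A) : Set ↥A)) : (S ⊓ A).relIndex A ≠ 0 := by
  haveI : CompactSpace ↥A := isCompact_iff_compactSpace.mp hA.isCompact
  haveI : Finite (↥A ⧸ (S ⊓ A).subgroupOf A) := Subgroup.quotient_finite_of_isOpen _ h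
  exact Subgroup.index_ne_zero_of_finite

/-- **Input I-C12i (vertices, finite-index form) from layer L3**: [CombGC] Prop 1.2 (i) for `G`
(`VerticialOpenInterDeterminesVertex`, the printed "if `A₁ ∩ A₂` is open in `A₁`, then `v₁ = v₂`")
gives, for the chosen `Π_v` of `X`, "`γ·Π_{v'}·γ⁻¹ ∩ Π_v` of finite index in `Π_v` (`γ ∈ Π_𝔾`)
`⇒ v' = v`" — the hypothesis `hDetv` of `prop13v_of_inputs` / `prop13vii_of_inputs`.
[cite: MochizukiCombGC2007, Prop 1.2(i) p.8] -/
theorem vertDet_of_psc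
    (hV : ∀ v, ∃ δ : ConjAct ↥X.PiG, (X.vertSub v).subgroupOf X.PiG = δ • G.vertGp (eV v))
    (hDet : G.VerticialOpenInterDeterminesVertex) :
    ∀ (v v' : X.Vert) (γ : X.PiH), γ ∈ X.PiG →
      (MulAut.conj γ • X.vertSub v' ⊓ X.vertSub v).relIndex (X.vertSub v) ≠ 0 → v' = v := by
  intro v v' γ hγ hidx
  obtain ⟨δ, hδ⟩ := hV v
  obtain ⟨δ', hδ'⟩ := hV v'
  -- read the finite-index statement inside `Π_𝔾`
  have h1 : ((MulAut.conj γ • X.vertSub v').subgroupOf X.PiG ⊓ (X.vertSub v).subgroupOf X.PiG).relIndex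
      ((X.vertSub v).subgroupOf X.PiG) ≠ 0 := by
    have h0 := hidx
    rw [← Subgroup.relIndex_subgroupOf (X.vertSub_le v)] at h0
    exact h0
  rw [show (γ : X.PiH) = ((⟨γ, hγ⟩ : ↥X.PiG) : X.PiH) from rfl, subgroupOf_conj_smul_of_mem, hδ', hδ,
    ← mul_smul] at h1
  -- [CombGC] Prop 1.2 (i) in its printed "open in" form, through the finite-index ⇒ open step of (A)
  have h2 : eV v = eV v' :=
    of_isOpen_inf_subgroupOf (isClosed_conjAct_smul (G.isClosed_vertGp (eV v')) _)
      (fun hopen => hDet (eV v) (eV v') δ (ConjAct.toConjAct (⟨γ, hγ⟩ : ↥X.PiG) * δ')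
        (by rwa [inf_comm] at hopen)) h1
  exact (eV.injective h2).symm

/-- **Input I-C12i (vertices, printed "open in" form)** — the hypothesis `hDetv` of
`prop13vi_of_inputs` (file (C)) — from layer L3's `VerticialOpenInterDeterminesVertex`.
[cite: MochizukiCombGC2007, Prop 1.2(i) p.8] -/
theorem vertDet_isOpen_form_of_psc
    (hV : ∀ v, ∃ δ : ConjAct ↥X.PiG, (X.vertSub v).subgroupOf X.PiG = δ • G.vertGp (eV v))
    (hDet : G.VerticialOpenInterDeterminesVertex) :
    ∀ (v v' : X.Vert) (γ : X.PiH), γ ∈ X.PiG →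
      IsOpen ((((MulAut.conj γ • X.vertSub v') ⊓ X.vertSub v).subgroupOf (X.vertSub v) :
        Subgroup ↥(X.vertSub v)) : Set ↥(X.vertSub v)) → v' = v :=
  fun v v' γ hγ hopen => X.vertDet_of_psc G eV hV hDet v v' γ hγ
    (X.relIndex_ne_zero_of_isOpen_subgroupOf (X.isClosed_vertSub_of_psc G eV hV v) hopen)

/-- **Input I-C12i (nodes, finite-index form) from layer L3** (`EdgeLikeOpenInterDeterminesEdge` at two
nodal edge-like subgroups). [cite: MochizukiCombGC2007, Prop 1.2(i) p.8] -/
theorem nodeDet_of_psc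
    (hN : ∀ e, ∃ δ : ConjAct ↥X.PiG, (X.nodeSub e).subgroupOf X.PiG = δ • G.nodeGp (eN e))
    (hDet : G.EdgeLikeOpenInterDeterminesEdge) :
    ∀ (e e' : X.Node) (γ : X.PiH), γ ∈ X.PiG →
      (MulAut.conj γ • X.nodeSub e' ⊓ X.nodeSub e).relIndex (X.nodeSub e) ≠ 0 → e' = e := by
  intro e e' γ hγ hidx
  obtain ⟨δ, hδ⟩ := hN e
  obtain ⟨δ', hδ'⟩ := hN e'
  have h1 : ((MulAut.conj γ • X.nodeSub e').subgroupOf X.PiG ⊓ (X.nodeSub e).subgroupOf X.PiG).relIndex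
      ((X.nodeSub e).subgroupOf X.PiG) ≠ 0 := by
    have h0 := hidx
    rw [← Subgroup.relIndex_subgroupOf (X.nodeSub_le e)] at h0
    exact h0
  rw [show (γ : X.PiH) = ((⟨γ, hγ⟩ : ↥X.PiG) : X.PiH) from rfl, subgroupOf_conj_smul_of_mem, hδ', hδ,
    ← mul_smul] at h1
  have h2 : (Sum.inl (eN e) : G.graph.N ⊕ G.graph.C) = Sum.inl (eN e') :=
    of_isOpen_inf_subgroupOf (isClosed_conjAct_smul (G.isClosed_nodeGp (eN e')) _)
      (fun hopen => hDet (Sum.inl (eN e)) (Sum.inl (eN e')) δ (ConjAct.toConjAct (⟨γ, hγ⟩ : ↥X.PiG) * δ')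
        (by rwa [inf_comm] at hopen)) h1
  exact (eN.injective (Sum.inl_injective h2)).symm

/-- **Input I-C12i (cusps, finite-index form) from layer L3** (`EdgeLikeOpenInterDeterminesEdge` at two
cuspidal edge-like subgroups). [cite: MochizukiCombGC2007, Prop 1.2(i) p.8] -/
theorem cuspDet_of_psc
    (hC : ∀ e, ∃ δ : ConjAct ↥X.PiG, (X.cuspSub e).subgroupOf X.PiG = δ • G.cuspGp (eC e))
    (hDet : G.EdgeLikeOpenInterDeterminesEdge) :
    ∀ (e e' : X.Cusp) (γ : X.PiH), γ ∈ X.PiG →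
      (MulAut.conj γ • X.cuspSub e' ⊓ X.cuspSub e).relIndex (X.cuspSub e) ≠ 0 → e' = e := by
  intro e e' γ hγ hidx
  obtain ⟨δ, hδ⟩ := hC e
  obtain ⟨δ', hδ'⟩ := hC e'
  have h1 : ((MulAut.conj γ • X.cuspSub e').subgroupOf X.PiG ⊓ (X.cuspSub e).subgroupOf X.PiG).relIndex
      ((X.cuspSub e).subgroupOf X.PiG) ≠ 0 := by
    have h0 := hidx
    rw [← Subgroup.relIndex_subgroupOf (X.cuspSub_le e)] at h0
    exact h0
  rw [show (γ : X.PiH) = ((⟨γ, hγ⟩ : ↥X.PiG) : X.PiH) from rfl, subgroupOf_conj_smul_of_mem, hδ', hδ,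
    ← mul_smul] at h1
  have h2 : (Sum.inr (eC e) : G.graph.N ⊕ G.graph.C) = Sum.inr (eC e') :=
    of_isOpen_inf_subgroupOf (isClosed_conjAct_smul (G.isClosed_cuspGp (eC e')) _)
      (fun hopen => hDet (Sum.inr (eC e)) (Sum.inr (eC e')) δ (ConjAct.toConjAct (⟨γ, hγ⟩ : ↥X.PiG) * δ')
        (by rwa [inf_comm] at hopen)) h1
  exact (eC.injective (Sum.inr_injective h2)).symm

end DPSCData

end Literature.AnabelianGeometry.AbsoluteAnabelian
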